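import Mathlib
import Literature.Analysis.FluidPDE.SpaceTimeRescaling
import Literature.Analysis.FluidPDE.PressureDeterminedUpToTime
import Literature.Analysis.FluidPDE.SelfSimilarCollapseAnsatz
import Summits.NavierStokesRegularity.NavierStokesRegularity.Theorems.EulerZoomLiouvillePowerGaugeEulerLiouvilleSelfSimilarPressureSlavingTools
import Summits.NavierStokesRegularity.NavierStokesRegularity.Theorems.EulerZoomLiouvillePowerGaugeEulerLiouvilleSelfSimilarPressureSlavingPastKill
import Summits.NavierStokesRegularity.NavierStokesRegularity.Theorems.EulerZoomLiouvillePowerGaugeEulerLiouvilleSelfSimilarPressureSlavingPastProfile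
import Summits.NavierStokesRegularity.NavierStokesRegularity.Theorems.EulerZoomLiouvillePowerGaugeEulerLiouvilleSelfSimilarPressureSlavingPastCovariance
import Summits.NavierStokesRegularity.NavierStokesRegularity.Theorems.EulerZoomLiouvillePowerGaugeEulerLiouvilleSelfSimilarPressureSlaving
import Summits.NavierStokesRegularity.NavierStokesRegularity.Theorems.EulerZoomLiouvillePowerGaugeEulerLiouvillePressureSwap
import HarnessLib

/-!
# Crux E `PowerGaugeEulerLiouville` (stmt-NavierStokesRegularity-19832): PRESSURE SLAVING FOR THE SHIFTED / PAST-EXACT STRATA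
# (lane «pressure slaving», file 2; LEAD ns-typeII-p2 g11 10:45:58Z (1); width seat ns-ezl-w3 g2)

Route `EulerZoomLiouville` (NavierStokesRegularity), crux E.  The past-exact strata of the census (`IsShiftedSelfSimilar ρ T x₀`,
`IsPastSelfSimilar ρ T T₁ x₀`, the past off-rate twin of v49) carry a VELOCITY clause `∀ τ < T₁, u τ = fun x => selfSimilarCollapse g T V τ (x − x₀)`
(`T₁ ≤ 0`, `T₁ ≤ T`) AND a PRESSURE clause `∀ τ < T₁, p τ = fun x => selfSimilarCollapsePressure g T P τ (x − x₀)`.  As for the origin-centred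
strata (`…SelfSimilarPressureSlaving`), the pressure clause is REDUNDANT; the only new point is that after centring at `(T, x₀)` the window
`s < S₁ := T₁ − T ≤ 0` is invariant under the self-similar dilations `β ≥ 1` ONLY, so the extraction of the profile is one-sided
(`…PastProfile`) and the `D`-growth is read on cylinders hanging from the window top (`…PastKill`, `…PastCovariance`).

* `ae_eq_rescaledPressure_top` — on the window slab, `q = q_β` a.e. for every `β ≥ 1` (two pressures of one velocity + Rusin–Šverák + growth);
* `exists_profilePressure_top` — hence `q = selfSimilarCollapsePressure g 0 Q` a.e. on the window slab (centred coordinates);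
* `exists_profilePressure_past` — **SLAVING, PAST FORM**: in the original coordinates, `p τ = fun x => selfSimilarCollapsePressure g T Q τ (x − x₀)`
  a.e. on `ℝ³` for a.e. `τ < T₁`, and a.e. on `(−∞, T₁) × ℝ³`;
* `inClass_pastSelfSimilarPressure` — **MEMBER FORM**: crux binders verbatim (`ρ > −1/2`) + the velocity clause ⇒ there are a measurable `Q` and a
  pressure `p'` with `p' = p` a.e. on the slab, `InClass ρ u p' H c` (ns-ezl-w2 g2's `PressureSwap.inClass_congr_pressure_ae`) and the EXACT
  pressure clause `∀ τ < T₁, p' τ = fun x => selfSimilarCollapsePressure g T Q τ (x − x₀)` (`p' τ := if τ < T₁ then … else p τ`).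

WHAT THIS IS NOT: not NS regularity, not the crux E — a de-conditioning lemma for the census of the crux CLASS 19832 on the MODEL lattice;
`--supports` stmt-19832.  [folklore; RusinSverak2011 §2 p. 4; CaffarelliKohnNirenberg1982 §2; ConstantinIgnatovaVicol2026Putative §3.1 (3.2)]
-/

noncomputable section

-- flat `Theorems/<Route><Decl>…` files of one crux share the namespace of the crux (tree convention: `Summit.<S>.<S>.…`)
set_option linter.dupNamespace false

open MeasureTheory Set Filter Topology Metric Function TopologicalSpace
open scoped ENNReal NNReal

namespace Summit.NavierStokesRegularity.NavierStokesRegularity.Theorems.PowerGaugeEulerLiouville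

open Literature.Analysis Literature.Analysis.FunctionSpaces Literature.Analysis.FluidPDE

namespace PressureSlaving

/-! ### Centred coordinates: `q = q_β` a.e. on the window slab, `β ≥ 1` -/

/-- **`q = q_β` A.E. ON THE WINDOW SLAB** `(−∞, S₁) × ℝ³`, `S₁ ≤ 0`, for `β ≥ 1`: `(w, q)` a distributional Euler solution there with
`w s = selfSimilarCollapse g 0 V s` (`s < S₁`) and `∫∫_{Q_a(S₁, 0)} |q|^{3/2} ≤ K a^m` for `a ≥ a₀` (`K < ∞`, `m < 3`) ⇒
`q(s, y) = β^{2(1−g)} q(β s, β^{g} y)` for a.e. `(s, y)` with `s < S₁`. [folklore; RusinSverak2011 §2 p. 4] -/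
theorem ae_eq_rescaledPressure_top {g β S₁ : ℝ} (hβ1 : 1 ≤ β) (hS : S₁ ≤ 0)
    {w : ℝ → EuclideanSpace ℝ (Fin 3) → EuclideanSpace ℝ (Fin 3)} {q : ℝ → EuclideanSpace ℝ (Fin 3) → ℝ}
    {V : EuclideanSpace ℝ (Fin 3) → EuclideanSpace ℝ (Fin 3)}
    (hdist : IsDistributionalNSSolutionOn (slab (EuclideanSpace ℝ (Fin 3)) (Iio S₁) isOpen_Iio) 0 0 w q)
    {K : ℝ≥0∞} (hK : K ≠ ⊤) {m a₀ : ℝ} (hm : m < 3)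
    (hD : ∀ a : ℝ, a₀ ≤ a →
      ∫⁻ z in parabolicCylinder a (S₁, (0 : EuclideanSpace ℝ (Fin 3))), ‖q z.1 z.2‖ₑ ^ (3 / 2 : ℝ) ≤ K * ENNReal.ofReal (a ^ m))
    (hw : ∀ s : ℝ, s < S₁ → w s = selfSimilarCollapse g 0 V s) :
    ∀ᵐ z ∂(volume.restrict (Iio S₁ ×ˢ (univ : Set (EuclideanSpace ℝ (Fin 3))))),
      q z.1 z.2 = (β ^ (1 - g)) ^ 2 * q (β * z.1) (β ^ g • z.2) := by
  have hβ : 0 < β := one_pos.trans_le hβ1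
  set γ : ℝ := β ^ g with hγdef
  have hγ : 0 < γ := Real.rpow_pos_of_pos hβ _
  set qb : ℝ → EuclideanSpace ℝ (Fin 3) → ℝ := (β ^ (1 - g)) ^ 2 • stPull β γ 0 (0 : EuclideanSpace ℝ (Fin 3)) q with hqb
  have hqb' : IsDistributionalNSSolutionOn (slab (EuclideanSpace ℝ (Fin 3)) (Iio S₁) isOpen_Iio) 0 0 w qb :=
    isDistributional_rescaledPressure_top hβ1 hS hdist hw
  set F : ℝ → EuclideanSpace ℝ (Fin 3) → ℝ := fun t x => q t x - qb t x with hFdef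
  suffices hF0 : ∀ᵐ z ∂(volume.restrict (Iio S₁ ×ˢ (univ : Set (EuclideanSpace ℝ (Fin 3))))), F z.1 z.2 = 0 by
    filter_upwards [hF0] with z hz
    have e : q z.1 z.2 = qb z.1 z.2 := sub_eq_zero.1 hz
    rw [e, hqb, smul_stPull_apply, zero_add, zero_add, smul_eq_mul]
  have hql : LocallyIntegrableOn (uncurry q) (Iio S₁ ×ˢ (univ : Set (EuclideanSpace ℝ (Fin 3)))) volume := by
    have h := hdist.2.2.1; rwa [coe_slab] at h
  have hqbl : LocallyIntegrableOn (uncurry qb) (Iio S₁ ×ˢ (univ : Set (EuclideanSpace ℝ (Fin 3)))) volume := by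
    have h := hqb'.2.2.1; rwa [coe_slab] at h
  have hFl : LocallyIntegrableOn (uncurry F) (Iio S₁ ×ˢ (univ : Set (EuclideanSpace ℝ (Fin 3)))) volume := hql.sub hqbl
  -- `F` is a function of time a.e. (two pressures of one velocity, on the slabs `(T', S₁) × ℝ³`)
  have hconstT : ∀ T' : ℝ, ∀ᵐ t ∂(volume.restrict (Ioo T' S₁)), ∃ κ : ℝ,
      ∀ᵐ x ∂(volume : Measure (EuclideanSpace ℝ (Fin 3))), F t x = κ := by
    intro T'
    have hle : slab (EuclideanSpace ℝ (Fin 3)) (Ioo T' S₁) isOpen_Ioo ≤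
        slab (EuclideanSpace ℝ (Fin 3)) (Iio S₁) isOpen_Iio := slab_mono Ioo_subset_Iio_self
    refine ae_exists_const_of_forall_integral_mul_divergence_eq_zero (hFl.mono_set (prod_mono Ioo_subset_Iio_self le_rfl)) ?_
    intro ψ hψ
    have h := setIntegral_sub_mul_divergence_eq_zero (hdist.of_le hle) (hqb'.of_le hle) hψ
    rwa [coe_slab] at h
  have hconst : ∀ᵐ t ∂(volume.restrict (Iio S₁)), ∃ κ : ℝ,
      ∀ᵐ x ∂(volume : Measure (EuclideanSpace ℝ (Fin 3))), F t x = κ := by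
    have hcover : Iio S₁ ⊆ ⋃ n : ℕ, Ioo (S₁ - ((n : ℝ) + 1)) S₁ := by
      intro t ht
      obtain ⟨n, hn⟩ := exists_nat_gt (S₁ - t)
      exact mem_iUnion.2 ⟨n, ⟨by linarith, ht⟩⟩
    exact ae_restrict_of_ae_restrict_of_subset hcover ((ae_restrict_iUnion_iff _ _).2 fun n => hconstT _)
  -- the growth of `F` on the cylinders hanging from the window top
  set L : ℝ := β + γ + |S₁| + 1 with hL
  have hL1 : 1 ≤ L := by rw [hL]; linarith [hγ.le, abs_nonneg S₁]
  set Kβ : ℝ≥0∞ := ‖(β ^ (1 - g)) ^ 2‖ₑ ^ (3 / 2 : ℝ) *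
    ENNReal.ofReal (β * γ ^ Module.finrank ℝ (EuclideanSpace ℝ (Fin 3)))⁻¹ with hKβ
  have hKβtop : Kβ ≠ ⊤ :=
    ENNReal.mul_ne_top (ENNReal.rpow_ne_top_of_nonneg (by norm_num) enorm_ne_top) ENNReal.ofReal_ne_top
  have hgrowth : ∀ a : ℝ, max a₀ 1 ≤ a →
      ∫⁻ z in parabolicCylinder a (S₁, (0 : EuclideanSpace ℝ (Fin 3))), ‖F z.1 z.2‖ₑ ^ (3 / 2 : ℝ) ≤
        (2 ^ ((3 / 2 : ℝ) - 1) * (K + Kβ * K * ENNReal.ofReal (L ^ m))) * ENNReal.ofReal (a ^ m) := by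
    intro a ha
    have ha₀ : a₀ ≤ a := (le_max_left _ _).trans ha
    have ha1 : 1 ≤ a := (le_max_right _ _).trans ha
    have ha0 : 0 < a := one_pos.trans_le ha1
    have hqa : ∫⁻ z in parabolicCylinder a (S₁, (0 : EuclideanSpace ℝ (Fin 3))), ‖qb z.1 z.2‖ₑ ^ (3 / 2 : ℝ) ≤
        Kβ * K * ENNReal.ofReal (L ^ m) * ENNReal.ofReal (a ^ m) := by
      have hsub := parabolicCylinder_subset_preimage_top hβ1 hγ hS ha1
      calc ∫⁻ z in parabolicCylinder a (S₁, (0 : EuclideanSpace ℝ (Fin 3))), ‖qb z.1 z.2‖ₑ ^ (3 / 2 : ℝ)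
          ≤ ∫⁻ z in stAffine β γ 0 (0 : EuclideanSpace ℝ (Fin 3)) ⁻¹'
              parabolicCylinder (L * a) (S₁, (0 : EuclideanSpace ℝ (Fin 3))), ‖qb z.1 z.2‖ₑ ^ (3 / 2 : ℝ) :=
            lintegral_mono_set hsub
        _ = Kβ * ∫⁻ z in parabolicCylinder (L * a) (S₁, (0 : EuclideanSpace ℝ (Fin 3))), ‖q z.1 z.2‖ₑ ^ (3 / 2 : ℝ) := by
            rw [hqb, setLIntegral_enorm_rpow_stRescale hβ hγ 0 (0 : EuclideanSpace ℝ (Fin 3)) _ q _ (by norm_num), hKβ]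
        _ ≤ Kβ * (K * ENNReal.ofReal ((L * a) ^ m)) := by
            gcongr
            exact hD _ (ha₀.trans (by nlinarith))
        _ = Kβ * K * ENNReal.ofReal (L ^ m) * ENNReal.ofReal (a ^ m) := by
            rw [Real.mul_rpow (by linarith) ha0.le, ENNReal.ofReal_mul (Real.rpow_nonneg (by linarith) _)]
            ring
    have hpa := hD a ha₀
    have hsubQ : parabolicCylinder a (S₁, (0 : EuclideanSpace ℝ (Fin 3))) ⊆
        Iio S₁ ×ˢ (univ : Set (EuclideanSpace ℝ (Fin 3))) := by
      rintro ⟨t, x⟩ hz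
      rw [mem_parabolicCylinder] at hz
      exact mem_prod.2 ⟨hz.1.2, mem_univ _⟩
    have hqmQ : AEMeasurable (fun z : ℝ × EuclideanSpace ℝ (Fin 3) => ‖q z.1 z.2‖ₑ ^ (3 / 2 : ℝ))
        (volume.restrict (parabolicCylinder a (S₁, (0 : EuclideanSpace ℝ (Fin 3))))) :=
      ((hql.aestronglyMeasurable.mono_measure (Measure.restrict_mono hsubQ le_rfl)).aemeasurable.enorm.pow_const _)
    calc ∫⁻ z in parabolicCylinder a (S₁, (0 : EuclideanSpace ℝ (Fin 3))), ‖F z.1 z.2‖ₑ ^ (3 / 2 : ℝ)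
        ≤ ∫⁻ z in parabolicCylinder a (S₁, (0 : EuclideanSpace ℝ (Fin 3))),
            2 ^ ((3 / 2 : ℝ) - 1) * (‖q z.1 z.2‖ₑ ^ (3 / 2 : ℝ) + ‖qb z.1 z.2‖ₑ ^ (3 / 2 : ℝ)) := by
          refine lintegral_mono fun z => ?_
          calc ‖F z.1 z.2‖ₑ ^ (3 / 2 : ℝ) ≤ (‖q z.1 z.2‖ₑ + ‖qb z.1 z.2‖ₑ) ^ (3 / 2 : ℝ) := by
                gcongr
                exact enorm_sub_le
            _ ≤ 2 ^ ((3 / 2 : ℝ) - 1) * (‖q z.1 z.2‖ₑ ^ (3 / 2 : ℝ) + ‖qb z.1 z.2‖ₑ ^ (3 / 2 : ℝ)) :=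
                ENNReal.rpow_add_le_mul_rpow_add_rpow _ _ (by norm_num)
      _ = 2 ^ ((3 / 2 : ℝ) - 1) * ((∫⁻ z in parabolicCylinder a (S₁, (0 : EuclideanSpace ℝ (Fin 3))), ‖q z.1 z.2‖ₑ ^ (3 / 2 : ℝ)) +
            ∫⁻ z in parabolicCylinder a (S₁, (0 : EuclideanSpace ℝ (Fin 3))), ‖qb z.1 z.2‖ₑ ^ (3 / 2 : ℝ)) := by
          rw [lintegral_const_mul' _ _ (ENNReal.rpow_ne_top_of_nonneg (by norm_num) ENNReal.ofNat_ne_top),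
            lintegral_add_left' hqmQ]
      _ ≤ 2 ^ ((3 / 2 : ℝ) - 1) * (K * ENNReal.ofReal (a ^ m) + Kβ * K * ENNReal.ofReal (L ^ m) * ENNReal.ofReal (a ^ m)) := by
          gcongr
      _ = (2 ^ ((3 / 2 : ℝ) - 1) * (K + Kβ * K * ENNReal.ofReal (L ^ m))) * ENNReal.ofReal (a ^ m) := by ring
  have hKtot : 2 ^ ((3 / 2 : ℝ) - 1) * (K + Kβ * K * ENNReal.ofReal (L ^ m)) ≠ ⊤ := by
    refine ENNReal.mul_ne_top (ENNReal.rpow_ne_top_of_nonneg (by norm_num) ENNReal.ofNat_ne_top) ?_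
    exact ENNReal.add_ne_top.2 ⟨hK, ENNReal.mul_ne_top (ENNReal.mul_ne_top hKβtop hK) ENNReal.ofReal_ne_top⟩
  exact ae_eq_zero_of_ae_const_of_cylinderGrowth_top (r := 3 / 2) (by norm_num) hFl.aestronglyMeasurable hconst hKtot hm hgrowth

/-- **SLAVING ON THE WINDOW SLAB (centred coordinates).**  Under the hypotheses of `ae_eq_rescaledPressure_top` there is a measurable profile `Q`
with `q s = selfSimilarCollapsePressure g 0 Q s` a.e. on `ℝ³` for a.e. `s < S₁`. [folklore] -/
theorem exists_profilePressure_top {g S₁ : ℝ} (hS : S₁ ≤ 0)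
    {w : ℝ → EuclideanSpace ℝ (Fin 3) → EuclideanSpace ℝ (Fin 3)} {q : ℝ → EuclideanSpace ℝ (Fin 3) → ℝ}
    {V : EuclideanSpace ℝ (Fin 3) → EuclideanSpace ℝ (Fin 3)}
    (hdist : IsDistributionalNSSolutionOn (slab (EuclideanSpace ℝ (Fin 3)) (Iio S₁) isOpen_Iio) 0 0 w q)
    {K : ℝ≥0∞} (hK : K ≠ ⊤) {m a₀ : ℝ} (hm : m < 3)
    (hD : ∀ a : ℝ, a₀ ≤ a →
      ∫⁻ z in parabolicCylinder a (S₁, (0 : EuclideanSpace ℝ (Fin 3))), ‖q z.1 z.2‖ₑ ^ (3 / 2 : ℝ) ≤ K * ENNReal.ofReal (a ^ m))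
    (hw : ∀ s : ℝ, s < S₁ → w s = selfSimilarCollapse g 0 V s) :
    ∃ Q : EuclideanSpace ℝ (Fin 3) → ℝ, Measurable Q ∧
      ∀ᵐ s ∂(volume.restrict (Iio S₁)), q s =ᵐ[volume] selfSimilarCollapsePressure g 0 Q s := by
  have hqm : AEStronglyMeasurable (uncurry q) (volume.restrict (Iio S₁ ×ˢ (univ : Set (EuclideanSpace ℝ (Fin 3))))) := by
    have h := hdist.2.2.1.aestronglyMeasurable; rwa [coe_slab] at h
  exact exists_profile_of_scaleInvariant_oneSided hS hqm
    (fun β hβ1 => ae_eq_rescaledPressure_top hβ1 hS hdist hK hm hD hw)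

/-! ### Back to the original coordinates -/

/-- **PRESSURE SLAVING, PAST FORM.**  Let `(u, p)` be a distributional Euler solution (no force) on the slab `(−∞,0) × ℝ³` with the `D`-type growth
`∫∫_{Q_a(0)} |p|^{3/2} ≤ K a^m` for `a ≥ a₀` (`K < ∞`, `m < 3`), and let the velocity be EXACTLY SELF-SIMILAR ABOUT `(T, x₀)` ON THE PAST WINDOW
`τ < T₁` (`T₁ ≤ 0`, `T₁ ≤ T`), of ANY rate `g`: `u τ = fun x => selfSimilarCollapse g T V τ (x − x₀)` for `τ < T₁`.  Then the pressure is the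
shifted ansatz of a measurable profile `Q` on that window: `p τ = fun x => selfSimilarCollapsePressure g T Q τ (x − x₀)` a.e. on `ℝ³` for a.e.
`τ < T₁`, and a.e. on `(−∞, T₁) × ℝ³`. [folklore; RusinSverak2011 §2 p. 4; CaffarelliKohnNirenberg1982 §2] -/
theorem exists_profilePressure_past {g T T₁ : ℝ} {x₀ : EuclideanSpace ℝ (Fin 3)} (hT₁ : T₁ ≤ 0) (hT : T₁ ≤ T)
    {u : ℝ → EuclideanSpace ℝ (Fin 3) → EuclideanSpace ℝ (Fin 3)} {p : ℝ → EuclideanSpace ℝ (Fin 3) → ℝ}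
    {V : EuclideanSpace ℝ (Fin 3) → EuclideanSpace ℝ (Fin 3)}
    (hdist : IsDistributionalNSSolutionOn (slab (EuclideanSpace ℝ (Fin 3)) (Iio 0) isOpen_Iio) 0 0 u p)
    {K : ℝ≥0∞} (hK : K ≠ ⊤) {m a₀ : ℝ} (hm : m < 3)
    (hD : ∀ a : ℝ, a₀ ≤ a →
      ∫⁻ z in parabolicCylinder a (0 : ℝ × EuclideanSpace ℝ (Fin 3)), ‖p z.1 z.2‖ₑ ^ (3 / 2 : ℝ) ≤ K * ENNReal.ofReal (a ^ m))
    (hu : ∀ τ : ℝ, τ < T₁ → u τ = fun x => selfSimilarCollapse g T V τ (x - x₀)) :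
    ∃ Q : EuclideanSpace ℝ (Fin 3) → ℝ, Measurable Q ∧
      (∀ᵐ τ ∂(volume.restrict (Iio T₁)),
        p τ =ᵐ[volume] fun x => selfSimilarCollapsePressure g T Q τ (x - x₀)) ∧
      ∀ᵐ z ∂(volume.restrict (Iio T₁ ×ˢ (univ : Set (EuclideanSpace ℝ (Fin 3))))),
        p z.1 z.2 = selfSimilarCollapsePressure g T Q z.1 (z.2 - x₀) := by
  set S₁ : ℝ := T₁ - T with hS₁
  have hS : S₁ ≤ 0 := by rw [hS₁]; linarith
  have hST : S₁ ≤ -T := by rw [hS₁]; linarith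
  set w : ℝ → EuclideanSpace ℝ (Fin 3) → EuclideanSpace ℝ (Fin 3) := stPull 1 1 T x₀ u with hwdef
  set q : ℝ → EuclideanSpace ℝ (Fin 3) → ℝ := stPull 1 1 T x₀ p with hqdef
  have hdist' : IsDistributionalNSSolutionOn (slab (EuclideanSpace ℝ (Fin 3)) (Iio S₁) isOpen_Iio) 0 0 w q :=
    isDistributional_shift hST x₀ hdist
  have hw : ∀ s : ℝ, s < S₁ → w s = selfSimilarCollapse g 0 V s := shift_selfSimilar hu
  -- the growth of `q` on the cylinders hanging from the window top
  set L₀ : ℝ := ‖x₀‖ + |T₁| + 2 with hL₀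
  have hL₀1 : 1 ≤ L₀ := by rw [hL₀]; linarith [norm_nonneg x₀, abs_nonneg T₁]
  have hD' : ∀ a : ℝ, max a₀ 1 ≤ a →
      ∫⁻ z in parabolicCylinder a (S₁, (0 : EuclideanSpace ℝ (Fin 3))), ‖q z.1 z.2‖ₑ ^ (3 / 2 : ℝ) ≤
        (K * ENNReal.ofReal (L₀ ^ m)) * ENNReal.ofReal (a ^ m) := by
    intro a ha
    have ha₀ : a₀ ≤ a := (le_max_left _ _).trans ha
    have ha1 : 1 ≤ a := (le_max_right _ _).trans ha
    have ha0 : 0 < a := one_pos.trans_le ha1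
    have e1 : q = (1 : ℝ) • stPull 1 1 T x₀ p := by rw [hqdef, one_smul]
    calc ∫⁻ z in parabolicCylinder a (S₁, (0 : EuclideanSpace ℝ (Fin 3))), ‖q z.1 z.2‖ₑ ^ (3 / 2 : ℝ)
        ≤ ∫⁻ z in stAffine 1 1 T x₀ ⁻¹' parabolicCylinder a (T₁, x₀), ‖q z.1 z.2‖ₑ ^ (3 / 2 : ℝ) :=
          lintegral_mono_set (parabolicCylinder_subset_preimage_shift T T₁ x₀ a)
      _ = ∫⁻ z in parabolicCylinder a (T₁, x₀), ‖p z.1 z.2‖ₑ ^ (3 / 2 : ℝ) := by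
          rw [e1, setLIntegral_enorm_rpow_stRescale one_pos one_pos T x₀ _ p _ (by norm_num)]
          simp
      _ ≤ ∫⁻ z in parabolicCylinder (L₀ * a) (0 : ℝ × EuclideanSpace ℝ (Fin 3)), ‖p z.1 z.2‖ₑ ^ (3 / 2 : ℝ) :=
          lintegral_mono_set (parabolicCylinder_shift_subset hT₁ x₀ ha1)
      _ ≤ K * ENNReal.ofReal ((L₀ * a) ^ m) := hD _ (ha₀.trans (by nlinarith))
      _ = (K * ENNReal.ofReal (L₀ ^ m)) * ENNReal.ofReal (a ^ m) := by
          rw [Real.mul_rpow (by linarith) ha0.le, ENNReal.ofReal_mul (Real.rpow_nonneg (by linarith) _), mul_assoc]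
  obtain ⟨Q, hQm, hQ⟩ := exists_profilePressure_top hS hdist' (ENNReal.mul_ne_top hK ENNReal.ofReal_ne_top) hm hD' hw
  -- un-shift: space
  have hQ' : ∀ᵐ s ∂(volume.restrict (Iio S₁)),
      p (T + s) =ᵐ[volume] fun x => selfSimilarCollapsePressure g T Q (T + s) (x - x₀) := by
    filter_upwards [hQ] with s hs
    have h1 := ((measurePreserving_sub_right (volume : Measure (EuclideanSpace ℝ (Fin 3))) x₀).quasiMeasurePreserving).ae hs
    filter_upwards [h1] with x hx
    have hx' : q s (x - x₀) = selfSimilarCollapsePressure g 0 Q s (x - x₀) := hx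
    rw [hqdef, stPull_apply, one_mul, one_smul, add_sub_cancel] at hx'
    rw [hx']
    simp only [selfSimilarCollapsePressure_apply, zero_sub, sub_add_cancel_left]
  -- un-shift: time
  have hslice : ∀ᵐ τ ∂(volume.restrict (Iio T₁)),
      p τ =ᵐ[volume] fun x => selfSimilarCollapsePressure g T Q τ (x - x₀) := by
    have h1 : ∀ᵐ s ∂(volume : Measure ℝ), s ∈ Iio S₁ →
        p (T + s) =ᵐ[volume] fun x => selfSimilarCollapsePressure g T Q (T + s) (x - x₀) :=
      (ae_restrict_iff' measurableSet_Iio).1 hQ'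
    have h2 := ((measurePreserving_sub_right (volume : Measure ℝ) T).quasiMeasurePreserving).ae h1
    refine (ae_restrict_iff' measurableSet_Iio).2 ?_
    filter_upwards [h2] with τ hτ hτT
    have hmem : τ - T ∈ Iio S₁ := by rw [mem_Iio, hS₁]; exact sub_lt_sub_right hτT T
    have := hτ hmem
    rwa [add_sub_cancel] at this
  refine ⟨Q, hQm, hslice, ?_⟩
  -- product form on `(−∞, T₁) × ℝ³`
  have hpm : AEStronglyMeasurable (uncurry p) (volume.restrict (Iio T₁ ×ˢ (univ : Set (EuclideanSpace ℝ (Fin 3))))) := by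
    have h := hdist.2.2.1
    rw [coe_slab] at h
    exact (h.mono_set (prod_mono (Iio_subset_Iio hT₁) le_rfl)).aestronglyMeasurable
  have hPm : AEStronglyMeasurable (uncurry fun τ x => selfSimilarCollapsePressure g T Q τ (x - x₀))
      (volume.restrict (Iio T₁ ×ˢ (univ : Set (EuclideanSpace ℝ (Fin 3))))) := by
    have e : (uncurry fun τ x => selfSimilarCollapsePressure g T Q τ (x - x₀)) =
        fun z : ℝ × EuclideanSpace ℝ (Fin 3) => (T - z.1) ^ (2 * (g - 1)) * Q ((T - z.1) ^ (-g) • (z.2 - x₀)) := by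
      funext z; rfl
    rw [e]
    exact (((measurable_fst.const_sub T).pow_const _).mul
      (hQm.comp (((measurable_fst.const_sub T).pow_const _).smul (measurable_snd.sub_const x₀)))).aestronglyMeasurable
  -- slices to slab at top `T₁`
  rw [volume_restrict_slab_eq_prod_top] at hpm hPm ⊢
  have hSm : MeasurableSet {z : ℝ × EuclideanSpace ℝ (Fin 3) |
      hpm.mk (uncurry p) z = hPm.mk (uncurry fun τ x => selfSimilarCollapsePressure g T Q τ (x - x₀)) z} :=
    hpm.stronglyMeasurable_mk.measurableSet_eq_fun hPm.stronglyMeasurable_mk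
  have h1 := Measure.ae_ae_of_ae_prod hpm.ae_eq_mk
  have h2 := Measure.ae_ae_of_ae_prod hPm.ae_eq_mk
  have h3 : ∀ᵐ τ ∂((volume : Measure ℝ).restrict (Iio T₁)), ∀ᵐ x ∂(volume : Measure (EuclideanSpace ℝ (Fin 3))),
      (τ, x) ∈ {z : ℝ × EuclideanSpace ℝ (Fin 3) |
        hpm.mk (uncurry p) z = hPm.mk (uncurry fun τ x => selfSimilarCollapsePressure g T Q τ (x - x₀)) z} := by
    filter_upwards [hslice, h1, h2] with τ hτ h1τ h2τ
    filter_upwards [hτ, h1τ, h2τ] with x hx h1x h2x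
    show hpm.mk (uncurry p) (τ, x) = hPm.mk (uncurry fun τ x => selfSimilarCollapsePressure g T Q τ (x - x₀)) (τ, x)
    rw [← h1x, ← h2x]
    exact hx
  have h4 := (Measure.ae_prod_mem_iff_ae_ae_mem hSm).2 h3
  filter_upwards [hpm.ae_eq_mk, hPm.ae_eq_mk, h4] with z hz1 hz2 hz
  have e : uncurry p z = (uncurry fun τ x => selfSimilarCollapsePressure g T Q τ (x - x₀)) z := by rw [hz1, hz2]; exact hz
  simpa only [uncurry] using e

/-! ### The member form -/

/-- **MEMBER FORM, PAST-EXACT STRATA.**  Crux binders verbatim (`InClass ρ u p H c` unfolded; any `ρ > −1/2`) + the velocity is exactly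
self-similar ABOUT `(T, x₀)` ON THE PAST WINDOW `τ < T₁` (`T₁ ≤ 0`, `T₁ ≤ T`), of ANY rate `g` ⇒ there are a measurable profile `Q` and a pressure
`p'` with: `p' = p` a.e. on the slab, `(u, p', H)` satisfies the three crux hypotheses with the SAME `c` (ns-ezl-w2 g2's
`PressureSwap.inClass_congr_pressure_ae`), and the EXACT pressure clause `∀ τ < T₁, p' τ = fun x => selfSimilarCollapsePressure g T Q τ (x − x₀)` of
`IsPastSelfSimilar` (`p' τ x := if τ < T₁ then … else p τ x`).  So the LEAD may delete the pressure clauses of the shifted / past-exact strata.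
[folklore; RusinSverak2011 §2 p. 4; CaffarelliKohnNirenberg1982 §2] -/
theorem inClass_pastSelfSimilarPressure {ρ g T T₁ : ℝ} {x₀ : EuclideanSpace ℝ (Fin 3)} (hρ : -1 / 2 < ρ) (hT₁ : T₁ ≤ 0) (hT : T₁ ≤ T)
    {u : ℝ → EuclideanSpace ℝ (Fin 3) → EuclideanSpace ℝ (Fin 3)} {p : ℝ → EuclideanSpace ℝ (Fin 3) → ℝ}
    {H : ℝ → EuclideanSpace ℝ (Fin 3) → EuclideanSpace ℝ (Fin 3) →L[ℝ] EuclideanSpace ℝ (Fin 3)} {c : ℝ≥0}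
    {V : EuclideanSpace ℝ (Fin 3) → EuclideanSpace ℝ (Fin 3)}
    (hcls : IsSuitableWeakSolutionOn (slab (EuclideanSpace ℝ (Fin 3)) (Iio 0) isOpen_Iio) 0 0 u p ∧
      HasWeakSpatialGradientOn (slab (EuclideanSpace ℝ (Fin 3)) (Iio 0) isOpen_Iio) u H ∧
      (∀ a : ℝ, 0 < a →
        ENNReal.ofReal (a ^ (2 * ρ)) * cknA a (0 : ℝ × EuclideanSpace ℝ (Fin 3)) u +
              ENNReal.ofReal (a ^ ρ) * cknE a (0 : ℝ × EuclideanSpace ℝ (Fin 3)) H +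
            ENNReal.ofReal (a ^ (2 * ρ)) * cknD a (0 : ℝ × EuclideanSpace ℝ (Fin 3)) p ≤ (c : ℝ≥0∞)))
    (hu : ∀ τ : ℝ, τ < T₁ → u τ = fun x => selfSimilarCollapse g T V τ (x - x₀)) :
    ∃ (Q : EuclideanSpace ℝ (Fin 3) → ℝ) (p' : ℝ → EuclideanSpace ℝ (Fin 3) → ℝ), Measurable Q ∧
      (∀ τ : ℝ, τ < T₁ → p' τ = fun x => selfSimilarCollapsePressure g T Q τ (x - x₀)) ∧
      (uncurry p' =ᵐ[volume.restrict (Iio (0 : ℝ) ×ˢ (univ : Set (EuclideanSpace ℝ (Fin 3))))] uncurry p) ∧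
      (IsSuitableWeakSolutionOn (slab (EuclideanSpace ℝ (Fin 3)) (Iio 0) isOpen_Iio) 0 0 u p' ∧
        HasWeakSpatialGradientOn (slab (EuclideanSpace ℝ (Fin 3)) (Iio 0) isOpen_Iio) u H ∧
        (∀ a : ℝ, 0 < a →
          ENNReal.ofReal (a ^ (2 * ρ)) * cknA a (0 : ℝ × EuclideanSpace ℝ (Fin 3)) u +
                ENNReal.ofReal (a ^ ρ) * cknE a (0 : ℝ × EuclideanSpace ℝ (Fin 3)) H +
              ENNReal.ofReal (a ^ (2 * ρ)) * cknD a (0 : ℝ × EuclideanSpace ℝ (Fin 3)) p' ≤ (c : ℝ≥0∞))) := by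
  obtain ⟨hsw, hH, hc⟩ := hcls
  have hcD : ∀ a : ℝ, 0 < a →
      ENNReal.ofReal (a ^ (2 * ρ)) * cknD a (0 : ℝ × EuclideanSpace ℝ (Fin 3)) p ≤ (c : ℝ≥0∞) :=
    fun a ha => le_trans le_add_self (hc a ha)
  have hD : ∀ a : ℝ, 1 ≤ a →
      ∫⁻ z in parabolicCylinder a (0 : ℝ × EuclideanSpace ℝ (Fin 3)), ‖p z.1 z.2‖ₑ ^ (3 / 2 : ℝ) ≤
        (c : ℝ≥0∞) * ENNReal.ofReal (a ^ (2 - 2 * ρ)) :=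
    fun a ha => lintegral_cylinder_le_of_gaugeD hcD (one_pos.trans_le ha)
  obtain ⟨Q, hQm, -, hQ⟩ := exists_profilePressure_past hT₁ hT hsw.distributional ENNReal.coe_ne_top (m := 2 - 2 * ρ)
    (by linarith) hD hu
  set p' : ℝ → EuclideanSpace ℝ (Fin 3) → ℝ := fun τ x =>
    if τ < T₁ then selfSimilarCollapsePressure g T Q τ (x - x₀) else p τ x with hp'
  have hpp : uncurry p' =ᵐ[volume.restrict (Iio (0 : ℝ) ×ˢ (univ : Set (EuclideanSpace ℝ (Fin 3))))] uncurry p := by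
    have h1 : ∀ᵐ z ∂(volume : Measure (ℝ × EuclideanSpace ℝ (Fin 3))),
        z ∈ Iio T₁ ×ˢ (univ : Set (EuclideanSpace ℝ (Fin 3))) → p z.1 z.2 = selfSimilarCollapsePressure g T Q z.1 (z.2 - x₀) :=
      (ae_restrict_iff' (measurableSet_Iio.prod MeasurableSet.univ)).1 hQ
    filter_upwards [ae_restrict_of_ae (μ := (volume : Measure (ℝ × EuclideanSpace ℝ (Fin 3))))
      (s := Iio (0 : ℝ) ×ˢ (univ : Set (EuclideanSpace ℝ (Fin 3)))) h1] with z hz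
    show p' z.1 z.2 = p z.1 z.2
    simp only [hp']
    split_ifs with hlt
    · exact (hz (mem_prod.2 ⟨hlt, mem_univ _⟩)).symm
    · rfl
  refine ⟨Q, p', hQm, fun τ hτ => ?_, hpp, PressureSwap.inClass_congr_pressure_ae ⟨hsw, hH, hc⟩ hpp⟩
  funext x
  simp only [hp', if_pos hτ]

end PressureSlaving

end Summit.NavierStokesRegularity.NavierStokesRegularity.Theorems.PowerGaugeEulerLiouville

end
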